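import Summits.ValiantsHypothesis.ValiantsHypothesis.Theses.DecompCycle1

/-!
# `DecompCycle1.Assembly` holds (bookkeeping item 23518 closed by proof)

The assembly item of route `DecompCycle1` (decomp-valiant workshop cycle 1 = VALIANT, writer file;
node N1 TameSensitivity) is the implication
`SensitiveHardPoly → TamePer → QuantHrubesPer → ValiantsHypothesis`, which is literally the route's
certified deciding theorem `closes` (D-0027 §2.1: the ε-sensitive monotone hardness of the permanent
at ε = 2^-(n^C+C), Hrubeš's bridge `QuantHrubesPer`, and the declared residual `TamePer`).  It is
closed here so that no decorative item remains open on the route (workshop critic, bus 527,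
2026-08-30T07:57:31Z, principle (i)); the route's open content is unchanged: the attacked crux
`SensitiveHardPoly` (item 23513), the declared residual `TamePer` (item 23514, split into
`PerNotSmVP` / `TameOrSmLift`), the load-bearing support `QuantHrubesPer` (item 23515) and the record
asides.  No tag, no rung changes (LADDER-Valiant rung 0; VP ≠ VNP is not proved by anything here).
-/

set_option linter.dupNamespace false

namespace Summit.ValiantsHypothesis.ValiantsHypothesis.Theorems.DecompCycle1Assembly

/-- **Item 23518 (`DecompCycle1.Assembly`) holds**:
`SensitiveHardPoly → TamePer → QuantHrubesPer → VP_ℂ ≠ VNP_ℂ` is the route's deciding theorem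
`closes` (Hrubeš's ε-sensitive bridge gives `PerNotTame` from `SensitiveHardPoly` and
`QuantHrubesPer`; `TamePer` is the residual `VP = VNP → per is tame`).
[cite: Hrubes2020, Thm 1 (ε-sensitive monotone lower bounds)] -/
theorem assembly_holds :
    Summit.ValiantsHypothesis.ValiantsHypothesis.Theses.DecompCycle1.Assembly :=
  fun hA hT hQ => Summit.ValiantsHypothesis.ValiantsHypothesis.Theses.DecompCycle1.closes hA hT hQ

end Summit.ValiantsHypothesis.ValiantsHypothesis.Theorems.DecompCycle1Assembly
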